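import Literature.Barriers.CriticalPhenomena.PlaquetteWalkHoleRootThinBoxTable
import Literature.Barriers.CriticalPhenomena.PlaquetteWalkMirrorDuality
import Literature.Barriers.CriticalPhenomena.PlaquetteWalkHoleRootFarCell
import HarnessLib

/-!
# Barrier catalogue (SAWScalingLimit): LAW L — THE ROW MIRROR OF A HOLED BOX at the level of the vertex functional, and the THIN-TOP TABLE by transport

Transport leaf (no new mechanism). `PlaquetteWalkMirrorDuality` §7 proves, for an ARBITRARY face list, that reflecting the
list, the root and the rhombus in a row conjugates the Yang–Baxter vertex functional of the printed weights and exchanges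
`θ ↔ π − θ` (`vertexFunctional_printed_map_mirrorRow_duality`); `vertexFunctional_printed_shiftBy`
(`YangBaxterSAWHexDictionary` §13) is translation invariance; `vertexFunctional_congr_dom` says the functional sees a face
list only through its face set. Put together for the lane's boxes `boxMinus m n S` (the `m × n` box minus the listed cells)
and the `W`-rooted hole frame (root `(h.1 + 1, h.2).side W`, far cell `farW`):

★★★★ `vertexFunctional_printed_boxMinus_rowMirror`: with `σ (x, y) = (x, n − 1 − y)` the reflection of the box in its
middle row, `VF_θ(boxMinus m n (S.map σ); (σ w).W; farW (σ w)) = conj VF_{π−θ}(boxMinus m n S; w.W; farW w)` — so every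
bottom-wall theorem of the catalogue about the VALUE of the far-cell functional is a top-wall theorem at the dual angle
(zero sets correspond, `vertexFunctional_printed_boxMinus_rowMirror_eq_zero_iff`; imaginary parts change sign,
`im_vertexFunctional_printed_boxMinus_rowMirror`; the hexagonal range `[π/3, 2π/3]` is self-dual).

★★★★★ `thinTop_cell_vertexFunctional_ne_zero` — the THIN-TOP INTERIOR TABLE, the row mirror of
`thinBox_cell_vertexFunctional_ne_zero` (`PlaquetteWalkHoleRootThinBoxTable`): hole one row BELOW the top wall
(`h.2 + 2 = n`), `≥ 3` columns from the side walls, `n ≥ 5`; remove ONE cell other than the hole, the far cell, the root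
plaquette, `farNW`, `farWW`, `farSW`, the cell above the hole, the cell above the root plaquette, and `pocketNE =
(h.1 + 2, n − 1)`: then `VF(θ) ≠ 0` on the whole range. (The excluded cells: `VF ≡ 0` for the doors and the two column
cells — `lawL_box_farNW_eq_zero`, `lawL_box_farWW_eq_zero`, `lawL_box_farSW_eq_zero`, `thinTopBox_holeN_…`,
`thinTopBox_rootN_…` of `PlaquetteWalkHoleRootThinTop`; `pocketNE` is the isolated zero at `π/3`,
`thinTopBox_pocketNE_vertexFunctional_pi_div_three_eq_zero`.) With `PlaquetteWalkHoleRootThinTop{,Walls}` this completes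
the thin-top mirror of the thin-box programme.

Not in print; venture lane «pcv-sawmu», seat b-step0 gen 27 (DESIGN-next-g27 §2.4 «orientation transport»).

References: A. Glazman, I. Manolescu, arXiv:1708.00395v3, §1 (remark after eq. (1): θ ↔ π − θ), §2.1, §4.2 (lattice
symmetries), Lemma 2.1 and eq. (2.2) [GlazmanManolescu2019]; A. Glazman, Electron. Commun. Probab. 20 (2015) no. 86,
Lemma 3.1 [Glazman2015WeightedSAW]; H. Duminil-Copin, S. Smirnov, Ann. of Math. 175 (2012), Lemma 1 [DuminilCopinSmirnov2012].
-/

noncomputable section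

open Set Function Complex

namespace Literature.Barriers.CriticalPhenomena.PlaquetteWalk

open Literature.Probability.RandomPlanarGeometry.SAW.YangBaxter
open Real Complex

section RowMirror

variable {m n : ℕ} {S : List Face}

/-- The reflection of the `m × n` box in its middle row: `(x, y) ↦ (x, n − 1 − y)`.
[cite: GlazmanManolescu2019, §4.2 (lattice symmetries)] -/
def boxRowMirror (n : ℕ) (f : Face) : Face := (f.1, (n : ℤ) - 1 - f.2)

/-- The box reflection is an involution. [cite: GlazmanManolescu2019, §4.2 (lattice symmetries)] -/
@[simp] theorem boxRowMirror_boxRowMirror (f : Face) : boxRowMirror n (boxRowMirror n f) = f := by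
  obtain ⟨x, y⟩ := f
  simp only [boxRowMirror, Prod.mk.injEq, true_and]
  ring

/-- The box reflection is the reflection in row `0` followed by the translation by `(0, n − 1)`.
[cite: GlazmanManolescu2019, §4.2 (lattice symmetries; translation invariance)] -/
theorem boxRowMirror_eq_shiftBy_mirrorRowFace (f : Face) :
    boxRowMirror n f = Face.shiftBy (0, (n : ℤ) - 1) (mirrorRowFace 0 f) := by
  obtain ⟨x, y⟩ := f
  simp only [boxRowMirror, Face.shiftBy, mirrorRowFace, Prod.mk.injEq]
  constructor <;> ring

/-- **The reflected holed box has the face set of the reflected-and-translated face list.**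
[cite: GlazmanManolescu2019, §2.1 (finite domains of faces), §4.2 (lattice symmetries)] -/
theorem dom_boxMinus_map_boxRowMirror :
    dom (boxMinus m n (S.map (boxRowMirror n))) =
      dom (((boxMinus m n S).map (mirrorRowFace 0)).map (Face.shiftBy (0, (n : ℤ) - 1))) := by
  ext f
  rw [mem_dom_boxMinus, dom_map_shiftBy, Set.mem_preimage, mem_dom_map_mirrorRowFace, mem_dom_boxMinus]
  obtain ⟨x, y⟩ := f
  simp only [Face.shiftBy, mirrorRowFace, Prod.neg_mk, neg_zero, add_zero, List.mem_map]
  constructor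
  · rintro ⟨⟨h1, h2, h3, h4⟩, hS⟩
    refine ⟨⟨h1, h2, by omega, by omega⟩, fun hmem => hS ⟨_, hmem, ?_⟩⟩
    simp only [boxRowMirror, Prod.mk.injEq, true_and]
    ring
  · rintro ⟨⟨h1, h2, h3, h4⟩, hS⟩
    refine ⟨⟨h1, h2, by omega, by omega⟩, ?_⟩
    rintro ⟨g, hg, hgf⟩
    apply hS
    obtain ⟨gx, gy⟩ := g
    simp only [boxRowMirror, Prod.mk.injEq] at hgf
    obtain ⟨rfl, hgy⟩ := hgf
    have : gy = 2 * 0 - (y + -((n : ℤ) - 1)) := by omega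
    rw [← this]
    exact hg

/-- ★★★★ **ROW-MIRROR TRANSPORT FOR HOLED BOXES**: reflecting the removed cells and the root plaquette of the `W`-rooted
hole frame in the middle row of the `m × n` box CONJUGATES the far-cell vertex functional of the printed weights and sends
`θ` to `π − θ`. [cite: GlazmanManolescu2019, Lemma 2.1, eq. (2.2) (CR); §1, remark after eq. (1) (θ ↔ π − θ); §4.2]
[cite: DuminilCopinSmirnov2012, Lemma 1 (shape of the relation)] -/
theorem vertexFunctional_printed_boxMinus_rowMirror (θ : ℝ) (w : Face) :
    vertexFunctional (printedWeights θ) tFiveEighths (ybCoeff θ) (boxMinus m n (S.map (boxRowMirror n)))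
        (Face.side (boxRowMirror n w) .W) (farW (boxRowMirror n w)) =
      (starRingEnd ℂ) (vertexFunctional (printedWeights (π - θ)) tFiveEighths (ybCoeff (π - θ)) (boxMinus m n S)
        (w.side .W) (farW w)) := by
  rw [vertexFunctional_congr_dom dom_boxMinus_map_boxRowMirror]
  obtain ⟨k, j⟩ := w
  have h1 : Face.side (boxRowMirror n (k, j)) .W = (mirrorRow 0 (Face.side (k, j) .W)).shiftBy (0, (n : ℤ) - 1) := by
    simp only [boxRowMirror, Face.side, mirrorRow, MidEdge.shiftBy]
    congr 1 <;> ring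
  have h2 : farW (boxRowMirror n (k, j)) = Face.shiftBy (0, (n : ℤ) - 1) (mirrorRowFace 0 (farW (k, j))) := by
    simp only [boxRowMirror, farW, Face.shiftBy, mirrorRowFace, Prod.mk.injEq]
    constructor <;> ring
  rw [h1, h2, vertexFunctional_printed_shiftBy, vertexFunctional_printed_map_mirrorRow_duality]

/-- ★★★ Zero sets correspond under the row mirror of the box (`θ ↔ π − θ`).
[cite: GlazmanManolescu2019, Lemma 2.1, eq. (2.2) (CR); §1, remark after eq. (1)] -/
theorem vertexFunctional_printed_boxMinus_rowMirror_eq_zero_iff (θ : ℝ) (w : Face) :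
    vertexFunctional (printedWeights θ) tFiveEighths (ybCoeff θ) (boxMinus m n (S.map (boxRowMirror n)))
        (Face.side (boxRowMirror n w) .W) (farW (boxRowMirror n w)) = 0 ↔
      vertexFunctional (printedWeights (π - θ)) tFiveEighths (ybCoeff (π - θ)) (boxMinus m n S) (w.side .W) (farW w) = 0 := by
  rw [vertexFunctional_printed_boxMinus_rowMirror, map_eq_zero]

/-- ★★★ Imaginary parts change sign under the row mirror of the box (`θ ↔ π − θ`).
[cite: GlazmanManolescu2019, Lemma 2.1, eq. (2.2) (CR); §1, remark after eq. (1)] -/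
theorem im_vertexFunctional_printed_boxMinus_rowMirror (θ : ℝ) (w : Face) :
    (vertexFunctional (printedWeights θ) tFiveEighths (ybCoeff θ) (boxMinus m n (S.map (boxRowMirror n)))
        (Face.side (boxRowMirror n w) .W) (farW (boxRowMirror n w))).im =
      -(vertexFunctional (printedWeights (π - θ)) tFiveEighths (ybCoeff (π - θ)) (boxMinus m n S) (w.side .W)
        (farW w)).im := by
  rw [vertexFunctional_printed_boxMinus_rowMirror, Complex.conj_im]

/-- The dual angle stays in the hexagonal range. [cite: GlazmanManolescu2019, §1, remark after eq. (1) (θ ↔ π − θ)] -/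
theorem pi_sub_mem_hexRange {θ : ℝ} (hθ : θ ∈ Set.Icc (π / 3) (2 * π / 3)) : π - θ ∈ Set.Icc (π / 3) (2 * π / 3) :=
  ⟨by linarith [hθ.2], by linarith [hθ.1]⟩

end RowMirror

/-! ## §2 The thin-top interior table by transport -/

section ThinTopTable

variable {m n : ℕ} {h : Face}

/-- ★★★★★ **THIN-TOP LAW L, THE INTERIOR TABLE** (row mirror of `thinBox_cell_vertexFunctional_ne_zero`): in the `m × n`
box with the hole `h` one row BELOW the top wall (`h.2 + 2 = n`) and at distance `≥ 3` from the west and east walls,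
`n ≥ 5`, remove the hole and ONE cell `(x, y)` which is none of: the hole, the far cell `(h.1 − 1, h.2)`, the root
plaquette `(h.1 + 1, h.2)`, the far cell's doors `farNW = (h.1 − 1, n − 1)`, `farWW = (h.1 − 2, h.2)`,
`farSW = (h.1 − 1, h.2 − 1)`, the cell above the hole `(h.1, n − 1)`, the cell above the root plaquette `(h.1 + 1, n − 1)`,
and `pocketNE = (h.1 + 2, n − 1)` (the isolated zero at `π/3`). Then `VF(θ) ≠ 0` for every `θ ∈ [π/3, 2π/3]`.
[cite: GlazmanManolescu2019, Lemma 2.1 (statement, "in the form given in [Gl]"), eq. (2.2), §2.1, §4.2]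
[cite: Glazman2015WeightedSAW, Lemma 3.1 (proof, pp. 6–7)] -/
theorem thinTop_cell_vertexFunctional_ne_zero (hW : 3 ≤ h.1) (hE : h.1 + 4 ≤ m) (hS : h.2 + 2 = n) (hN : 5 ≤ n)
    {x y : ℤ}
    (hc : ¬((x = h.1 ∧ y = h.2) ∨ (x = h.1 - 1 ∧ y = h.2) ∨ (x = h.1 + 1 ∧ y = h.2) ∨ (x = h.1 - 1 ∧ y = h.2 + 1) ∨
      (x = h.1 - 2 ∧ y = h.2) ∨ (x = h.1 - 1 ∧ y = h.2 - 1) ∨ (x = h.1 ∧ y = h.2 + 1) ∨ (x = h.1 + 1 ∧ y = h.2 + 1) ∨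
      (x = h.1 + 2 ∧ y = h.2 + 1)))
    {θ : ℝ} (hθ : θ ∈ Set.Icc (π / 3) (2 * π / 3)) :
    vertexFunctional (printedWeights θ) tFiveEighths (ybCoeff θ) (boxMinus m n [h, (x, y)]) (Face.side (h.1 + 1, h.2) .W)
      (farW (h.1 + 1, h.2)) ≠ 0 := by
  -- the mirrored data: hole `(h.1, 1)`, cell `(x, n − 1 − y)`
  have hlist : [h, (x, y)] = [((h.1, 1) : Face), (x, (n : ℤ) - 1 - y)].map (boxRowMirror n) := by
    obtain ⟨a, b⟩ := h
    simp only [List.map_cons, List.map_nil, boxRowMirror, List.cons.injEq, Prod.mk.injEq, and_true, true_and]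
    simp only at hS
    constructor
    · omega
    · ring
  have hroot : ((h.1 + 1, h.2) : Face) = boxRowMirror n ((h.1 + 1, 1) : Face) := by
    simp only [boxRowMirror, Prod.mk.injEq, true_and]
    omega
  rw [hlist, hroot, Ne, vertexFunctional_printed_boxMinus_rowMirror_eq_zero_iff]
  have key := thinBox_cell_vertexFunctional_ne_zero (m := m) (n := n) (h := ((h.1, 1) : Face)) (x := x)
    (y := (n : ℤ) - 1 - y) hW hE rfl hN (by simp only; omega) (pi_sub_mem_hexRange hθ)
  exact key

end ThinTopTable

/-! ## §3 The height-four box with the hole one row below the top wall: the five bottom-row cells, by transport -/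

section ThinTopFour

variable {m n : ℕ} {h : Face}

/-- ★★★★ **Height four, hole one row below the top wall, `K_S1 = (h.1 − 2, 0)` removed: `VF(π/3) = 0` EXACTLY** (row
mirror of `thinBox4_killNW_vertexFunctional_two_pi_div_three_eq_zero`). [cite: GlazmanManolescu2019, Lemma 2.1, eq. (2.2) (CR), §4.2]
[cite: Glazman2015WeightedSAW, Lemma 3.1 (proof, pp. 6–7)] -/
theorem thinTop4_killSW_vertexFunctional_pi_div_three_eq_zero (hW : 2 ≤ h.1) (hE : h.1 + 3 ≤ m) (hS : h.2 = 2)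
    (hN : h.2 + 2 = n) :
    vertexFunctional (printedWeights (π / 3)) tFiveEighths (ybCoeff (π / 3)) (boxMinus m n [h, (h.1 - 2, h.2 - 2)])
      (Face.side (h.1 + 1, h.2) .W) (farW (h.1 + 1, h.2)) = 0 := by
  have hlist : [h, (h.1 - 2, h.2 - 2)] = [((h.1, 1) : Face), killNW ((h.1 + 1, 1) : Face)].map (boxRowMirror n) := by
    obtain ⟨a, b⟩ := h
    simp only at hS hN
    simp only [List.map_cons, List.map_nil, boxRowMirror, killNW, List.cons.injEq, Prod.mk.injEq, true_and,
      and_true]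
    omega
  have hroot : ((h.1 + 1, h.2) : Face) = boxRowMirror n ((h.1 + 1, 1) : Face) := by
    simp only [boxRowMirror, Prod.mk.injEq, true_and]
    omega
  have e : π / 3 = π - 2 * π / 3 := by ring
  rw [hlist, hroot, e, vertexFunctional_printed_boxMinus_rowMirror_eq_zero_iff, sub_sub_cancel]
  exact thinBox4_killNW_vertexFunctional_two_pi_div_three_eq_zero (h := ((h.1, 1) : Face)) hW hE rfl (by simp only; omega)

/-- ★★★★ … and `Im VF < 0` on `(π/3, 2π/3]`: an ISOLATED zero at `π/3` (row mirror of `thinBox4_killNW_im_pos_of_lt`).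
[cite: GlazmanManolescu2019, Lemma 2.1, eq. (2.2) (CR), §4.2] [cite: Glazman2015WeightedSAW, Lemma 3.1 (proof, pp. 6–7)] -/
theorem thinTop4_killSW_im_neg_of_gt (hW : 2 ≤ h.1) (hE : h.1 + 3 ≤ m) (hS : h.2 = 2) (hN : h.2 + 2 = n) {θ : ℝ}
    (hθ : θ ∈ Set.Ioc (π / 3) (2 * π / 3)) :
    (vertexFunctional (printedWeights θ) tFiveEighths (ybCoeff θ) (boxMinus m n [h, (h.1 - 2, h.2 - 2)])
      (Face.side (h.1 + 1, h.2) .W) (farW (h.1 + 1, h.2))).im < 0 := by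
  have hlist : [h, (h.1 - 2, h.2 - 2)] = [((h.1, 1) : Face), killNW ((h.1 + 1, 1) : Face)].map (boxRowMirror n) := by
    obtain ⟨a, b⟩ := h
    simp only at hS hN
    simp only [List.map_cons, List.map_nil, boxRowMirror, killNW, List.cons.injEq, Prod.mk.injEq, true_and,
      and_true]
    omega
  have hroot : ((h.1 + 1, h.2) : Face) = boxRowMirror n ((h.1 + 1, 1) : Face) := by
    simp only [boxRowMirror, Prod.mk.injEq, true_and]
    omega
  rw [hlist, hroot, im_vertexFunctional_printed_boxMinus_rowMirror, neg_lt_zero]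
  exact thinBox4_killNW_im_pos_of_lt (h := ((h.1, 1) : Face)) hW hE rfl (by simp only; omega)
    ⟨by linarith [hθ.2], by linarith [hθ.1]⟩

/-- ★★★★ **Height four, hole one row below the top wall, `K_S2 = (h.1 + 2, 0)` removed: `VF(2π/3) = 0` EXACTLY** (row
mirror of `thinBox4_killNE_vertexFunctional_pi_div_three_eq_zero`). [cite: GlazmanManolescu2019, Lemma 2.1, eq. (2.2) (CR), §4.2]
[cite: Glazman2015WeightedSAW, Lemma 3.1 (proof, pp. 6–7)] -/
theorem thinTop4_killSE_vertexFunctional_two_pi_div_three_eq_zero (hW : 2 ≤ h.1) (hE : h.1 + 3 ≤ m) (hS : h.2 = 2)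
    (hN : h.2 + 2 = n) :
    vertexFunctional (printedWeights (2 * π / 3)) tFiveEighths (ybCoeff (2 * π / 3)) (boxMinus m n [h, (h.1 + 2, h.2 - 2)])
      (Face.side (h.1 + 1, h.2) .W) (farW (h.1 + 1, h.2)) = 0 := by
  have hlist : [h, (h.1 + 2, h.2 - 2)] = [((h.1, 1) : Face), killNE ((h.1 + 1, 1) : Face)].map (boxRowMirror n) := by
    obtain ⟨a, b⟩ := h
    simp only at hS hN
    simp only [List.map_cons, List.map_nil, boxRowMirror, killNE, List.cons.injEq, Prod.mk.injEq, true_and,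
      and_true]
    omega
  have hroot : ((h.1 + 1, h.2) : Face) = boxRowMirror n ((h.1 + 1, 1) : Face) := by
    simp only [boxRowMirror, Prod.mk.injEq, true_and]
    omega
  have e : 2 * π / 3 = π - π / 3 := by ring
  rw [hlist, hroot, e, vertexFunctional_printed_boxMinus_rowMirror_eq_zero_iff, sub_sub_cancel]
  exact thinBox4_killNE_vertexFunctional_pi_div_three_eq_zero (h := ((h.1, 1) : Face)) hW hE rfl (by simp only; omega)

/-- ★★★★ … and `Im VF < 0` on `[π/3, 2π/3)`: an ISOLATED zero at `2π/3` (row mirror of `thinBox4_killNE_im_pos_of_gt`).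
[cite: GlazmanManolescu2019, Lemma 2.1, eq. (2.2) (CR), §4.2] [cite: Glazman2015WeightedSAW, Lemma 3.1 (proof, pp. 6–7)] -/
theorem thinTop4_killSE_im_neg_of_lt (hW : 2 ≤ h.1) (hE : h.1 + 3 ≤ m) (hS : h.2 = 2) (hN : h.2 + 2 = n) {θ : ℝ}
    (hθ : θ ∈ Set.Ico (π / 3) (2 * π / 3)) :
    (vertexFunctional (printedWeights θ) tFiveEighths (ybCoeff θ) (boxMinus m n [h, (h.1 + 2, h.2 - 2)])
      (Face.side (h.1 + 1, h.2) .W) (farW (h.1 + 1, h.2))).im < 0 := by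
  have hlist : [h, (h.1 + 2, h.2 - 2)] = [((h.1, 1) : Face), killNE ((h.1 + 1, 1) : Face)].map (boxRowMirror n) := by
    obtain ⟨a, b⟩ := h
    simp only at hS hN
    simp only [List.map_cons, List.map_nil, boxRowMirror, killNE, List.cons.injEq, Prod.mk.injEq, true_and,
      and_true]
    omega
  have hroot : ((h.1 + 1, h.2) : Face) = boxRowMirror n ((h.1 + 1, 1) : Face) := by
    simp only [boxRowMirror, Prod.mk.injEq, true_and]
    omega
  rw [hlist, hroot, im_vertexFunctional_printed_boxMinus_rowMirror, neg_lt_zero]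
  exact thinBox4_killNE_im_pos_of_gt (h := ((h.1, 1) : Face)) hW hE rfl (by simp only; omega)
    ⟨by linarith [hθ.2], by linarith [hθ.1]⟩

/-- ★★★ Height four, hole one row below the top wall, the cell `(h.1 − 1, 0)` two rows below the far cell removed:
`VF ≡ 0` on the range (row mirror of `thinBox4_farNWN_vertexFunctional_eq_zero`).
[cite: GlazmanManolescu2019, Lemma 2.1, eq. (2.2) (CR), §4.2] [cite: Glazman2015WeightedSAW, Lemma 3.1 (proof, pp. 6–7)] -/
theorem thinTop4_farSWS_vertexFunctional_eq_zero (hW : 2 ≤ h.1) (hE : h.1 + 3 ≤ m) (hS : h.2 = 2) (hN : h.2 + 2 = n)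
    {θ : ℝ} (hθ : θ ∈ Set.Icc (π / 3) (2 * π / 3)) :
    vertexFunctional (printedWeights θ) tFiveEighths (ybCoeff θ) (boxMinus m n [h, (h.1 - 1, h.2 - 2)])
      (Face.side (h.1 + 1, h.2) .W) (farW (h.1 + 1, h.2)) = 0 := by
  have hlist : [h, (h.1 - 1, h.2 - 2)] = [((h.1, 1) : Face), (((h.1 : ℤ) - 1, (3 : ℤ)) : Face)].map (boxRowMirror n) := by
    obtain ⟨a, b⟩ := h
    simp only at hS hN
    simp only [List.map_cons, List.map_nil, boxRowMirror, List.cons.injEq, Prod.mk.injEq, true_and,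
      and_true]
    omega
  have hroot : ((h.1 + 1, h.2) : Face) = boxRowMirror n ((h.1 + 1, 1) : Face) := by
    simp only [boxRowMirror, Prod.mk.injEq, true_and]
    omega
  rw [hlist, hroot, vertexFunctional_printed_boxMinus_rowMirror_eq_zero_iff]
  exact thinBox4_farNWN_vertexFunctional_eq_zero (h := ((h.1, 1) : Face)) hW hE rfl (by simp only; omega)
    (pi_sub_mem_hexRange hθ)

/-- ★★★ Height four, hole one row below the top wall, the cell `(h.1, 0)` two rows below the hole removed: `VF ≡ 0` on the
range (row mirror of `thinBox4_holeNN_vertexFunctional_eq_zero`).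
[cite: GlazmanManolescu2019, Lemma 2.1, eq. (2.2) (CR), §4.2] [cite: Glazman2015WeightedSAW, Lemma 3.1 (proof, pp. 6–7)] -/
theorem thinTop4_holeSS_vertexFunctional_eq_zero (hW : 2 ≤ h.1) (hE : h.1 + 3 ≤ m) (hS : h.2 = 2) (hN : h.2 + 2 = n)
    {θ : ℝ} (hθ : θ ∈ Set.Icc (π / 3) (2 * π / 3)) :
    vertexFunctional (printedWeights θ) tFiveEighths (ybCoeff θ) (boxMinus m n [h, (h.1, h.2 - 2)])
      (Face.side (h.1 + 1, h.2) .W) (farW (h.1 + 1, h.2)) = 0 := by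
  have hlist : [h, (h.1, h.2 - 2)] = [((h.1, 1) : Face), (((h.1 : ℤ), (3 : ℤ)) : Face)].map (boxRowMirror n) := by
    obtain ⟨a, b⟩ := h
    simp only at hS hN
    simp only [List.map_cons, List.map_nil, boxRowMirror, List.cons.injEq, Prod.mk.injEq, true_and,
      and_true]
    omega
  have hroot : ((h.1 + 1, h.2) : Face) = boxRowMirror n ((h.1 + 1, 1) : Face) := by
    simp only [boxRowMirror, Prod.mk.injEq, true_and]
    omega
  rw [hlist, hroot, vertexFunctional_printed_boxMinus_rowMirror_eq_zero_iff]
  exact thinBox4_holeNN_vertexFunctional_eq_zero (h := ((h.1, 1) : Face)) hW hE rfl (by simp only; omega)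
    (pi_sub_mem_hexRange hθ)

/-- ★★★★ Height four, hole one row below the top wall, the cell `(h.1 + 1, 0)` two rows below the root plaquette removed:
`VF(2π/3) = 0` exactly (row mirror of `thinBox4_rootNN_vertexFunctional_pi_div_three_eq_zero`).
[cite: GlazmanManolescu2019, Lemma 2.1, eq. (2.2) (CR), §4.2] [cite: Glazman2015WeightedSAW, Lemma 3.1 (proof, pp. 6–7)] -/
theorem thinTop4_rootSS_vertexFunctional_two_pi_div_three_eq_zero (hW : 2 ≤ h.1) (hE : h.1 + 3 ≤ m) (hS : h.2 = 2)
    (hN : h.2 + 2 = n) :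
    vertexFunctional (printedWeights (2 * π / 3)) tFiveEighths (ybCoeff (2 * π / 3)) (boxMinus m n [h, (h.1 + 1, h.2 - 2)])
      (Face.side (h.1 + 1, h.2) .W) (farW (h.1 + 1, h.2)) = 0 := by
  have hlist : [h, (h.1 + 1, h.2 - 2)] = [((h.1, 1) : Face), (((h.1 : ℤ) + 1, (3 : ℤ)) : Face)].map (boxRowMirror n) := by
    obtain ⟨a, b⟩ := h
    simp only at hS hN
    simp only [List.map_cons, List.map_nil, boxRowMirror, List.cons.injEq, Prod.mk.injEq, true_and,
      and_true]
    omega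
  have hroot : ((h.1 + 1, h.2) : Face) = boxRowMirror n ((h.1 + 1, 1) : Face) := by
    simp only [boxRowMirror, Prod.mk.injEq, true_and]
    omega
  have e : 2 * π / 3 = π - π / 3 := by ring
  rw [hlist, hroot, e, vertexFunctional_printed_boxMinus_rowMirror_eq_zero_iff, sub_sub_cancel]
  exact thinBox4_rootNN_vertexFunctional_pi_div_three_eq_zero (h := ((h.1, 1) : Face)) hW hE rfl (by simp only; omega)

end ThinTopFour

end Literature.Barriers.CriticalPhenomena.PlaquetteWalk
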